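import Mathlib
import Summits.Ventures.HodgeRepro.LitRank

/-!
# LitRankLeopoldt — Kubota's Lemma 3 (Leopoldt) reduced to the non-vanishing of
`Θ = Σ_{a=1}^{p-1} ψ(a)·a` (Kubota 1965 p.120–121, the elementary half of the printed proof)

Blind cell `pub-hodge-repro`, seat lit-2 (gen 5).  Companion of `LitRank.lean` (same seat).  Kubota
1965 (store `paper:doi-10-1090-s0002-9947-1965-0190144-8`) proves Lemma 3 (p0008:L36–L40: "Let
p = 2m + 1 be an odd prime number, and let ψ be a character of the group of nonzero residue classes
of Z/(p) such that ψ(−1) = −1.  Then Σ_{a=1}^{m} ψ(a) ≠ 0") as follows (p0008:L41–p0009:L54):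
"Consider the sum Θ = Σ_{a=1}^{2m} ψ(a)a.  Then we have always Θ ≠ 0, because Θ is a factor contained
in the class number formula for the pth cyclotomic field.  Set now A = Σ_{a=1}^{m} ψ(a)a,
A′ = Σ_{a=m+1}^{2m} ψ(a)a, A₁ = Σ ψ(2a−1)(2a−1), A₂ = Σ ψ(2a)·2a, B = Σ_{a=1}^{m} ψ(a), …
[(3) Θ = 2A − pB, (4) Θ = 4ψ(2)A − pψ(2)B] … (1 − 2ψ(2))Θ = p(1 − ψ(2))B − p(1 − 2ψ(2))B = pψ(2)B.
This shows B ≠ 0, which proves the lemma."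

This file PROVES the elementary half — the identity `(1 − 2ψ(2))·Θ = p·ψ(2)·B`
(`Leopoldt.key_identity`) and the deduction `Θ ≠ 0 ⟹ B ≠ 0` (`Kubota1965_lemma3_of_theta`) — so that
the named fact `Kubota1965_lemma3_Leopoldt` is CLOSED MODULO the single analytic input
"Θ ≠ 0 for every odd character ψ mod p", i.e. the non-vanishing of the generalised Bernoulli number
`B_{1,ψ} = Θ/p`, equivalently `L(0, ψ) ≠ 0` (Mathlib has `L(1, χ) ≠ 0` and the functional equation, but
not yet the value `L(0, χ) = −B_{1,χ}`: TODO in `Mathlib/NumberTheory/LSeries/HurwitzZetaValues.lean`).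
The analytic input is taken as a HYPOTHESIS of the conditional theorem, not minted as a new named fact
(D-0026).
-/

namespace HodgeRepro.Lit2

namespace Leopoldt

open Finset

variable (p : ℕ) [hp : Fact p.Prime]

/-- The character `ψ` of `(ℤ/p)ˣ` extended by `0` to `ℤ/p` (a complex-valued function). -/
noncomputable def ext (ψ : (ZMod p)ˣ →* ℂˣ) (x : ZMod p) : ℂ :=
  if hx : x = 0 then 0 else (ψ (Units.mk0 x hx) : ℂ)

variable (ψ : (ZMod p)ˣ →* ℂˣ)

/-- `ψ̃(0) = 0`. -/
theorem ext_zero : ext p ψ 0 = 0 := by simp [ext]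

/-- On units, `ψ̃` is `ψ`. -/
theorem ext_unit (u : (ZMod p)ˣ) : ext p ψ u = ψ u := by
  simp [ext, u.ne_zero, Units.mk0_val]

/-- `ψ̃` is multiplicative on all of `ℤ/p`. -/
theorem ext_mul (x y : ZMod p) : ext p ψ (x * y) = ext p ψ x * ext p ψ y := by
  unfold ext
  by_cases hx : x = 0
  · simp [hx]
  by_cases hy : y = 0
  · simp [hy]
  have hxy : x * y ≠ 0 := mul_ne_zero hx hy
  rw [dif_neg hxy, dif_neg hx, dif_neg hy, ← Units.val_mul, ← map_mul]
  congr 2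
  ext
  simp

/-- For an odd character, `ψ̃(−x) = −ψ̃(x)`. -/
theorem ext_neg (hψ : ψ (-1) = -1) (x : ZMod p) : ext p ψ (-x) = - ext p ψ x := by
  have h1 : ext p ψ (-1) = -1 := by
    have : ((-1 : (ZMod p)ˣ) : ZMod p) = -1 := by simp
    rw [← this, ext_unit, hψ]; simp
  rw [← neg_one_mul, ext_mul, h1, neg_one_mul]

/-- Kubota's `Θ = Σ_{a=1}^{p−1} ψ(a)·a` (p0008:L41–L46). -/
noncomputable def theta : ℂ := ∑ j ∈ range (p - 1), ext p ψ ((j + 1 : ℕ) : ZMod p) * ((j + 1 : ℕ) : ℂ)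

/-- Kubota's `B = Σ_{a=1}^{m} ψ(a)`, `m = (p−1)/2` (p0008:L68). -/
noncomputable def halfSum : ℂ := ∑ j ∈ range ((p - 1) / 2), ext p ψ ((j + 1 : ℕ) : ZMod p)

/-- Kubota's `A = Σ_{a=1}^{m} ψ(a)·a` (p0008:L53). -/
noncomputable def halfA : ℂ :=
  ∑ j ∈ range ((p - 1) / 2), ext p ψ ((j + 1 : ℕ) : ZMod p) * ((j + 1 : ℕ) : ℂ)

omit hp in
/-- Even/odd split of a sum over `range (2m)`. -/
theorem sum_range_two_mul (f : ℕ → ℂ) (m : ℕ) :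
    ∑ j ∈ range (2 * m), f j = ∑ i ∈ range m, (f (2 * i) + f (2 * i + 1)) := by
  induction m with
  | zero => simp
  | succ m ih =>
    rw [show 2 * (m + 1) = 2 * m + 1 + 1 by ring, sum_range_succ, sum_range_succ, ih, sum_range_succ]
    ring

/-- Kubota's (3): `Θ = 2A − pB` (p0009, the reflection `a ↦ p − a`). -/
theorem theta_eq_halfA (hψ : ψ (-1) = -1) (hp2 : p ≠ 2) :
    theta p ψ = 2 * halfA p ψ - p * halfSum p ψ := by
  have hodd : Odd p := hp.out.odd_of_ne_two hp2
  obtain ⟨m, hm⟩ := hodd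
  have hm' : (p - 1) / 2 = m := by omega
  have hp1 : p - 1 = m + m := by omega
  unfold theta halfA halfSum
  rw [hm', hp1, sum_range_add]
  -- the second block reflected: `m + j + 1 = p − (m − 1 − j + 1)`
  have hrefl : ∑ j ∈ range m, ext p ψ ((m + j + 1 : ℕ) : ZMod p) * ((m + j + 1 : ℕ) : ℂ) =
      ∑ j ∈ range m, (- ext p ψ ((j + 1 : ℕ) : ZMod p)) * ((p : ℂ) - ((j + 1 : ℕ) : ℂ)) := by
    rw [← sum_range_reflect (fun j => (- ext p ψ ((j + 1 : ℕ) : ZMod p)) * ((p : ℂ) - ((j + 1 : ℕ) : ℂ))) m]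
    refine sum_congr rfl fun j hj => ?_
    rw [mem_range] at hj
    have e1 : ((m + j + 1 : ℕ) : ZMod p) = -((m - 1 - j + 1 : ℕ) : ZMod p) := by
      have : (m + j + 1 : ℕ) + (m - 1 - j + 1 : ℕ) = p := by omega
      rw [eq_neg_iff_add_eq_zero, ← Nat.cast_add, this, ZMod.natCast_self]
    have e2 : ((m + j + 1 : ℕ) : ℂ) = (p : ℂ) - ((m - 1 - j + 1 : ℕ) : ℂ) := by
      rw [eq_sub_iff_add_eq, ← Nat.cast_add]
      congr 1; omega
    rw [e1, ext_neg p ψ hψ, e2]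
  rw [hrefl, ← sum_add_distrib, mul_sum, mul_sum, ← sum_sub_distrib]
  refine sum_congr rfl fun j _ => ?_
  ring

/-- Kubota's (4): `Θ = 4ψ(2)A − pψ(2)B` (p0009:L42–L46, the even/odd split). -/
theorem theta_eq_halfA' (hψ : ψ (-1) = -1) (hp2 : p ≠ 2) :
    theta p ψ = 4 * ext p ψ 2 * halfA p ψ - p * ext p ψ 2 * halfSum p ψ := by
  have hodd : Odd p := hp.out.odd_of_ne_two hp2
  obtain ⟨m, hm⟩ := hodd
  have hm' : (p - 1) / 2 = m := by omega
  have hp1 : p - 1 = 2 * m := by omega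
  unfold theta halfA halfSum
  rw [hm', hp1, sum_range_two_mul]
  -- even terms: `ψ(2(i+1))·2(i+1) = ψ(2)ψ(i+1)·2(i+1)`; odd terms: `2i+1 = p − 2(m−i)`
  have heven : ∀ i ∈ range m, ext p ψ ((2 * i + 1 + 1 : ℕ) : ZMod p) * ((2 * i + 1 + 1 : ℕ) : ℂ) =
      ext p ψ 2 * (ext p ψ ((i + 1 : ℕ) : ZMod p) * ((i + 1 : ℕ) : ℂ)) * 2 := by
    intro i _
    have e1 : ((2 * i + 1 + 1 : ℕ) : ZMod p) = 2 * ((i + 1 : ℕ) : ZMod p) := by push_cast; ring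
    have e2 : ((2 * i + 1 + 1 : ℕ) : ℂ) = 2 * ((i + 1 : ℕ) : ℂ) := by push_cast; ring
    rw [e1, e2, ext_mul]
    ring
  have hodd' : ∑ i ∈ range m, ext p ψ ((2 * i + 1 : ℕ) : ZMod p) * ((2 * i + 1 : ℕ) : ℂ) =
      ∑ i ∈ range m, (- ext p ψ 2 * ext p ψ ((i + 1 : ℕ) : ZMod p)) *
        ((p : ℂ) - 2 * ((i + 1 : ℕ) : ℂ)) := by
    rw [← sum_range_reflect (fun i => (- ext p ψ 2 * ext p ψ ((i + 1 : ℕ) : ZMod p)) *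
        ((p : ℂ) - 2 * ((i + 1 : ℕ) : ℂ))) m]
    refine sum_congr rfl fun i hi => ?_
    rw [mem_range] at hi
    have hsum' : (2 * i + 1 : ℕ) + 2 * (m - 1 - i + 1 : ℕ) = p := by omega
    have e1 : ((2 * i + 1 : ℕ) : ZMod p) = -(2 * ((m - 1 - i + 1 : ℕ) : ZMod p)) := by
      have h := congrArg (fun n : ℕ => (n : ZMod p)) hsum'
      simp only [Nat.cast_add, Nat.cast_mul, Nat.cast_ofNat, Nat.cast_one, ZMod.natCast_self] at h
      rw [eq_neg_iff_add_eq_zero]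
      push_cast
      linear_combination h
    have e2 : ((2 * i + 1 : ℕ) : ℂ) = (p : ℂ) - 2 * ((m - 1 - i + 1 : ℕ) : ℂ) := by
      have h := congrArg (fun n : ℕ => (n : ℂ)) hsum'
      simp only [Nat.cast_add, Nat.cast_mul, Nat.cast_ofNat, Nat.cast_one] at h
      rw [eq_sub_iff_add_eq]
      push_cast
      linear_combination h
    rw [e1, ext_neg p ψ hψ, ext_mul, e2]
    ring
  rw [sum_add_distrib, hodd', sum_congr rfl heven, ← sum_add_distrib, mul_sum, mul_sum,
    ← sum_sub_distrib]
  refine sum_congr rfl fun i _ => ?_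
  ring

/-- **Kubota's identity `(1 − 2ψ(2))Θ = pψ(2)B`** (p0009:L48–L53). -/
theorem key_identity (hψ : ψ (-1) = -1) (hp2 : p ≠ 2) :
    (1 - 2 * ext p ψ 2) * theta p ψ = p * ext p ψ 2 * halfSum p ψ := by
  have h3 := theta_eq_halfA p ψ hψ hp2
  have h4 := theta_eq_halfA' p ψ hψ hp2
  linear_combination h4 - 2 * ext p ψ 2 * h3

/-- `ψ(2)` is a root of unity, so `1 − 2ψ(2) ≠ 0`. -/
theorem one_sub_two_mul_ext_two_ne_zero (hp2 : p ≠ 2) : 1 - 2 * ext p ψ 2 ≠ 0 := by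
  have h2 : (2 : ZMod p) ≠ 0 := by
    intro h
    have := (ZMod.natCast_eq_zero_iff 2 p).mp (by exact_mod_cast h)
    exact hp2 ((Nat.prime_dvd_prime_iff_eq hp.out Nat.prime_two).mp this)
  set u : (ZMod p)ˣ := Units.mk0 2 h2 with hu
  have hext : ext p ψ 2 = ψ u := by rw [← ext_unit p ψ u]; simp [hu]
  have hpow : (ψ u : ℂ) ^ (p - 1) = 1 := by
    rw [← Units.val_pow_eq_pow_val, ← map_pow, ← ZMod.card_units p, pow_card_eq_one, map_one,
      Units.val_one]
  have hnorm : ‖(ψ u : ℂ)‖ = 1 :=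
    Complex.norm_eq_one_of_pow_eq_one hpow (by have := hp.out.two_le; omega)
  intro h0
  have : (ψ u : ℂ) = 1 / 2 := by rw [← hext]; linear_combination -h0 / 2
  rw [this] at hnorm
  norm_num at hnorm

end Leopoldt

open Leopoldt in
/-- **Kubota 1965, Lemma 3 (Leopoldt) follows from `Θ ≠ 0`**: the elementary half of Kubota's
printed proof (p0008:L41–p0009:L54), with the class-number-formula input "Θ ≠ 0" as a hypothesis. -/
theorem Kubota1965_lemma3_of_theta
    (hΘ : ∀ (p : ℕ) [Fact p.Prime], p ≠ 2 → ∀ ψ : (ZMod p)ˣ →* ℂˣ, ψ (-1) = -1 → theta p ψ ≠ 0) :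
    Kubota1965_lemma3_Leopoldt := by
  intro p _ hp hp2 ψ hψ
  haveI := Fact.mk hp
  have hkey := key_identity p ψ hψ hp2
  have hne := one_sub_two_mul_ext_two_ne_zero p ψ hp2
  have hΘ' := hΘ p hp2 ψ hψ
  -- the statement's sum is `halfSum`
  have hsum : (∑ a ∈ (Finset.univ : Finset (ZMod p)ˣ).filter
      (fun a : (ZMod p)ˣ => (a : ZMod p).val ≤ (p - 1) / 2), (ψ a : ℂ)) = halfSum p ψ := by
    unfold halfSum
    have hp1 := hp.one_lt
    refine Finset.sum_nbij' (fun a => (a : ZMod p).val - 1)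
      (fun k => if h : ((k + 1 : ℕ) : ZMod p) ≠ 0 then Units.mk0 _ h else 1) ?_ ?_ ?_ ?_ ?_
    · intro a ha
      rw [Finset.mem_filter] at ha
      rw [Finset.mem_range]
      have h0 : (a : ZMod p).val ≠ 0 := by
        rw [Ne, ZMod.val_eq_zero]; exact a.ne_zero
      omega
    · intro k hk
      rw [Finset.mem_range] at hk
      rw [Finset.mem_filter]
      refine ⟨Finset.mem_univ _, ?_⟩
      have hlt : k + 1 < p := by omega
      have hne : ((k + 1 : ℕ) : ZMod p) ≠ 0 := by
        rw [Ne, ZMod.natCast_eq_zero_iff]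
        exact fun h => absurd (Nat.le_of_dvd (by omega) h) (by omega)
      rw [dif_pos hne, Units.val_mk0, ZMod.val_natCast, Nat.mod_eq_of_lt hlt]
      omega
    · intro a ha
      rw [Finset.mem_filter] at ha
      have h0 : (a : ZMod p).val ≠ 0 := by
        rw [Ne, ZMod.val_eq_zero]; exact a.ne_zero
      have e : (((a : ZMod p).val - 1 + 1 : ℕ) : ZMod p) = (a : ZMod p) := by
        rw [Nat.sub_add_cancel (by omega), ZMod.natCast_zmod_val]
      simp only [e, a.ne_zero, ne_eq, not_false_eq_true, dif_pos]
      exact Units.mk0_val _ _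
    · intro k hk
      rw [Finset.mem_range] at hk
      have hlt : k + 1 < p := by omega
      have hne : ((k + 1 : ℕ) : ZMod p) ≠ 0 := by
        rw [Ne, ZMod.natCast_eq_zero_iff]
        exact fun h => absurd (Nat.le_of_dvd (by omega) h) (by omega)
      simp only [hne, ne_eq, not_false_eq_true, dif_pos, Units.val_mk0, ZMod.val_natCast,
        Nat.mod_eq_of_lt hlt]
      omega
    · intro a ha
      rw [Finset.mem_filter] at ha
      have h0 : (a : ZMod p).val ≠ 0 := by
        rw [Ne, ZMod.val_eq_zero]; exact a.ne_zero
      have e : (((a : ZMod p).val - 1 + 1 : ℕ) : ZMod p) = (a : ZMod p) := by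
        rw [Nat.sub_add_cancel (by omega), ZMod.natCast_zmod_val]
      rw [e, ext_unit]
  intro hB
  rw [hsum] at hB
  rw [hB, mul_zero] at hkey
  exact hΘ' ((mul_eq_zero.mp hkey).resolve_left hne)

end HodgeRepro.Lit2
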